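import Summits.QuantumFields.YangMills.Theorems.BalabanUVNodesN21SelectedThresholdsHistories
import Summits.QuantumFields.YangMills.Theorems.BalabanUVNodesN21SelectedThresholdsTransport

/-!
# YM-DAG node N21 (= NE7c) — ROW A⁗ «THE ENVELOPE IS RESUMMATION»: module 20's three displayed law binders (`henv`, `hmass`, `hdep`) DISCHARGED from the
# partition-of-unity identity (RESUM) `Σ_τ histLaw^X_τ = γ^X_t` + the level-0 source tilt (TILT), with ONE t-free law `γ0^X K` per run for every slot and every
# assignment (`hdep := rfl`) — lens Card 14 (`LENS-nearmiss.md` v6.0), the lens's `Sketch-nearmiss-g6.lean` §A∕§B∕§C∕§D VERBATIM + road I's `ShellWeightBound`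

Track A of `YM-PLAN.md` (cell `pub-ymgap`, HUMAN RULING D-0062), node **N21**; R134 fan-out seat `pub-ymgap-dag-n21-d` (s2), generation 5, module 20e.  THEOREMS ONLY:
0 `def`, 0 `sorry`, standard axioms; COUNT-NEUTRAL; `--supports` the K3‴ item `SpineGivenEndpointR13` (stmt-QuantumFields-19912) as a helper.  NO Theses import, NO
`Node00.Record13` import.  §A–§D ARE the planner seat `ym-lens-BalabanUVNodes-nearmiss` g6's farm-checked sketch `Sketch-nearmiss-g6.lean` (sha16 0c87d1bc897efdaa)
§A ∕ §B ∕ §C ∕ §D VERBATIM (namespace renamed; CREDIT: ym-lens-BalabanUVNodes-nearmiss g6, memo `LENS-nearmiss.md` v6.0 5a5eb79e1354f382, Card 14, FAN-OUT ROW A⁗), as 18a ∕ 20b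
were g4's ∕ g5's; §C′ is this seat's one-line junction to road I.  Imports module 20 `BalabanUVNodesN21SelectedThresholdsHistories` (p491967: `toReal_le_of_le_smul`,
`partialLaw_le_of_sum_histLaw_le`, `levelLedgers_histories_of_selectedThresholds`) and module 20b `BalabanUVNodesN21SelectedThresholdsTransport` (p492847:
`withDensity_le_smul`, `le_smul_withDensity`).  The sketch's §E (the MODEL-A constructor for which (RESUM) is a THEOREM; 4 defs) is the sibling definition-lane module
20f `BalabanUVNodesN21HistoriesModelADefs`.

THE POINT (lens Card 14).  After module 20 the law side of N21's histories road was: per run and slot an older-measurable envelope law with `hdep`, the envelope `henv :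
partialLaw ≤ M₁ • law`, the mass control `hmass`.  Take ONE t-free finite law `γ0^X K` per run (run X's `t = 0` law pulled back to the common space) for EVERY slot and
assignment ⇒ `hdep := rfl`; `henv` ⇐ (RESUM, upper) `Σ_{τ ∈ T K} histLaw^X_τ ≤ γ^X_t` + (TILT, upper) `γ^X_t ≤ M • γ0^X` (§A `envelope_of_resummation`, via module 20 §1);
`hmass` ⇐ (RESUM, exact) + (TILT, lower) `γ0^X ≤ M • γ^X_t` (§A `massControl_of_resummation`, `M₂ = M⁻¹`); (TILT) at level 0 is §B `tilt_sandwich` (`γ_t := e^{tF}·γ_0`,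
`|F| ≤ B_F`, `|t| ≤ l₀` ⇒ `M = e^{l₀B_F}`, 20b's `withDensity_le_smul` ∕ `le_smul_withDensity`).  §C `levelLedgers_histories_of_resummation` = module 20 §3 with those binders
REPLACED (`D_j = (M∕M⁻¹)·2ν̄∕((1 − ρ_j)κ_j)`); §C′ `shellWeightBound_histories_of_resummation` (∘ n21-a `n21_knit_levels_geometric`); §D `map_fst_withDensity_comp_fst`
(a coupling's one-coordinate tilt commutes with that marginal — for Card 16's product∕disjoint-union common space).

HONEST FRAMING (binding).  DISPLAYED after this file on the histories road: (RESUM) = the SHAPE of NODE O's term object (a partition of unity inserted under ONE integral —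
module 20f proves it for the model-A constructor, nothing of Bałaban's instantiated), (TILT) (a level-0 bounded source), N16's a.e. closeness by level, N20's window∕count,
the admissible box.  [folklore] measure theory; nothing of Bałaban's asserted; (M1) for print's FIXED thresholds untouched; NE7c is NOT PRINTED and NOT PROVED; **N21 is
NOT discharged**; typed 28∕28, discharged count untouched; one finite four-torus programme at fixed `ε` — NOT ℝ⁴, NOT infinite volume, NOT OS, NOT a mass gap, NOT Clay.
No decl below carries a cite tag.
-/

set_option autoImplicit false

noncomputable section

open scoped BigOperators ENNReal
open MeasureTheory Set

namespace Summit.QuantumFields.YangMills.Theorems.N21SelectedThresholdsHistoriesResummation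

open Literature.MathematicalPhysics.QuantumFieldTheory.Balaban1983to89
open Literature.MathematicalPhysics.QuantumFieldTheory.Balaban1983to89.T4ShellMeasure (SlotAntiConcentration)
open T4IndicatorShell (ShellWeightBound)
open T4ShellMeasureLevels (LevelLedger LiveWindow)
open Summit.QuantumFields.YangMills.Theorems.N21SelectedThresholds (levelConst_le)
open Summit.QuantumFields.BalabanUV.T4Continuum.ShellMeasureRootCompositionHistories
  (histWeight histShell histPiece histLaw partialLaw isFiniteMeasure_histLaw histLaw_univ_toReal)
open Summit.QuantumFields.YangMills.Theorems.N21SelectedThresholdsHistories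
  (toReal_le_of_le_smul partialLaw_le_of_sum_histLaw_le levelLedgers_histories_of_selectedThresholds)
open Summit.QuantumFields.YangMills.Theorems.N21SelectedThresholdsTransport (withDensity_le_smul le_smul_withDensity)

/-! ## §A resummation ⇒ envelope and mass control -/

section Resummation

variable {Ω σ ι : Type*} [MeasurableSpace Ω] [DecidableEq σ]

/-- (RESUM, upper) + (TILT, upper) ⇒ module 20's `henv` for EVERY slot: `partialLaw_s ≤ Σ_τ histLaw_τ ≤ γ_t ≤ M • γ_0`. [folklore] -/
theorem envelope_of_resummation (T : Finset ι) (ν : ι → Measure Ω) (small : ι → Finset σ) (u : σ → Ω → ℝ) (ϑ : σ → ℝ)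
    {γt γ0 : Measure Ω} {M : ℝ≥0∞} (hres : ∑ τ ∈ T, histLaw (ν τ) (small τ) u ϑ ≤ γt) (htilt : γt ≤ M • γ0) (s : σ) :
    partialLaw T ν small u ϑ s ≤ M • γ0 :=
  partialLaw_le_of_sum_histLaw_le T ν small u ϑ (hres.trans htilt) s

omit [DecidableEq σ] in
/-- (RESUM, exact) ⇒ the total of the history weights IS the tilted law's mass: `Σ_τ A_τ = γ_t(univ)`. [folklore] -/
theorem sum_histWeight_eq_of_resummation (T : Finset ι) (ν : ι → Measure Ω) [∀ τ, IsFiniteMeasure (ν τ)]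
    (small : ι → Finset σ) {u : σ → Ω → ℝ} (hu : ∀ s, Measurable (u s)) (ϑ : σ → ℝ) {γt : Measure Ω}
    (hres : ∑ τ ∈ T, histLaw (ν τ) (small τ) u ϑ = γt) :
    ∑ τ ∈ T, histWeight (ν τ) (small τ) u ϑ = (γt univ).toReal := by
  haveI : ∀ τ, IsFiniteMeasure (histLaw (ν τ) (small τ) u ϑ) := fun τ => isFiniteMeasure_histLaw _ _ _ _
  rw [← hres, Measure.finsetSum_apply, ENNReal.toReal_sum fun τ _ => measure_ne_top _ _]
  exact Finset.sum_congr rfl fun τ _ => (histLaw_univ_toReal (ν τ) (small τ) hu ϑ).symm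

omit [DecidableEq σ] in
/-- (RESUM, exact) + (TILT, lower) ⇒ module 20's `hmass` with `M₂ = M⁻¹`: `M⁻¹ · γ_0(univ) ≤ γ_t(univ) = Σ_τ A_τ`. [folklore] -/
theorem massControl_of_resummation (T : Finset ι) (ν : ι → Measure Ω) [∀ τ, IsFiniteMeasure (ν τ)]
    (small : ι → Finset σ) {u : σ → Ω → ℝ} (hu : ∀ s, Measurable (u s)) (ϑ : σ → ℝ) {γt γ0 : Measure Ω}
    (hres : ∑ τ ∈ T, histLaw (ν τ) (small τ) u ϑ = γt) {M : ℝ} (hM : 0 < M) (htilt : γ0 ≤ ENNReal.ofReal M • γt) :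
    M⁻¹ * (γ0 univ).toReal ≤ ∑ τ ∈ T, histWeight (ν τ) (small τ) u ϑ := by
  haveI : ∀ τ, IsFiniteMeasure (histLaw (ν τ) (small τ) u ϑ) := fun τ => isFiniteMeasure_histLaw _ _ _ _
  haveI : IsFiniteMeasure γt := by rw [← hres]; infer_instance
  rw [sum_histWeight_eq_of_resummation T ν small hu ϑ hres]
  have h := toReal_le_of_le_smul hM.le htilt univ
  calc M⁻¹ * (γ0 univ).toReal ≤ M⁻¹ * (M * (γt univ).toReal) := by gcongr
    _ = (γt univ).toReal := by field_simp

end Resummation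

/-! ## §B the source tilt at level 0 -/

section Tilt

variable {Ω : Type*} [MeasurableSpace Ω]

/-- **THE LEVEL-0 SOURCE TILT IS A TWO-SIDED SANDWICH**: `γ_t := e^{tF} · γ_0` with `|F| ≤ B_F`, `|t| ≤ l₀` gives
`γ_t ≤ e^{l₀B_F} • γ_0` and `γ_0 ≤ e^{l₀B_F} • γ_t` (module 20b's `withDensity_le_smul` ∕ `le_smul_withDensity`). [folklore] -/
theorem tilt_sandwich (γ0 : Measure Ω) {F : Ω → ℝ} (hF : Measurable F) {BF l₀ t : ℝ} (hB : ∀ ω, |F ω| ≤ BF) (ht : |t| ≤ l₀) :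
    γ0.withDensity (fun ω => ENNReal.ofReal (Real.exp (t * F ω))) ≤ ENNReal.ofReal (Real.exp (l₀ * BF)) • γ0 ∧
    γ0 ≤ ENNReal.ofReal (Real.exp (l₀ * BF)) • γ0.withDensity (fun ω => ENNReal.ofReal (Real.exp (t * F ω))) := by
  have hl₀ : 0 ≤ l₀ := (abs_nonneg t).trans ht
  have hbd : ∀ ω, |t * F ω| ≤ l₀ * BF := fun ω => by
    rw [abs_mul]; exact mul_le_mul ht (hB ω) (abs_nonneg _) hl₀
  have hmeas : Measurable fun ω => ENNReal.ofReal (Real.exp (t * F ω)) :=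
    (Real.measurable_exp.comp (measurable_const.mul hF)).ennreal_ofReal
  refine ⟨withDensity_le_smul γ0 fun ω => ?_, le_smul_withDensity γ0 hmeas fun ω => ?_⟩
  · exact ENNReal.ofReal_le_ofReal (Real.exp_le_exp.2 ((le_abs_self _).trans (hbd ω)))
  · rw [← ENNReal.ofReal_mul (Real.exp_pos _).le, ← Real.exp_add, ← ENNReal.ofReal_one]
    refine ENNReal.ofReal_le_ofReal ?_
    have h1 : 0 ≤ l₀ * BF + t * F ω := by
      have := (neg_abs_le _).trans (le_refl (t * F ω)); have := hbd ω; linarith [neg_abs_le (t * F ω), abs_nonneg (t * F ω)]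
    have := Real.add_one_le_exp (l₀ * BF + t * F ω)
    linarith

end Tilt

/-! ## §C the junction: module 20 §3 from (RESUM) + (TILT), one t-free law for everything -/

section Junction

variable {Ω : ℕ → Type*} [∀ K, MeasurableSpace (Ω K)] {σ ι : Type*} [DecidableEq σ]
  {T : ℕ → Finset ι} {C : ℕ → Finset σ} {small : ℕ → ι → Finset σ} {lvl : ℕ → σ → ℕ}
  {νA νB : ∀ K : ℕ, (ℕ → ℝ) → ℝ → ι → Measure (Ω K)} [∀ K a t τ, IsFiniteMeasure (νA K a t τ)] [∀ K a t τ, IsFiniteMeasure (νB K a t τ)]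
  {γ0A γ0B : ∀ K : ℕ, Measure (Ω K)} [∀ K, IsFiniteMeasure (γ0A K)] [∀ K, IsFiniteMeasure (γ0B K)]
  {γtA γtB : ∀ K : ℕ, ℝ → Measure (Ω K)}
  {uA uB : ∀ K : ℕ, σ → Ω K → ℝ} {θ κ ρ Δ : ℕ → ℝ} {l₀ M νbar : ℝ}

/-- **BOTH RUNS' HISTORY LEDGERS AT THE SAME SELECTED THRESHOLDS, FROM RESUMMATION.**  Module 20's
`levelLedgers_histories_of_selectedThresholds` with `law^X K a s := γ0^X K` (ONE t-free finite law PER RUN on the common space,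
the same for every slot and every assignment — in the reading: run X's t = 0 law pulled back to the common space `Ω K`, e.g. the
disjoint union of the two runs' initial configuration spaces), `M₁ := M`, `M₂ := M⁻¹`; its binders `hdepA∕B` are `rfl`,
`henvA∕B` and `hmassA∕B` follow from (RESUM) `Σ_{τ ∈ T K} histLaw^X_τ = γ^X_t` at every admissible assignment (the expansion is a
partition of unity inserted under ONE integral — thresholds only move mass between histories) and (TILT) `γ^X_t ≤ M • γ0`,
`γ0 ≤ M • γ^X_t` (§B at level 0).  Displayed after this: (RESUM) = the SHAPE of NODE O's term object, (TILT), N16's a.e.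
closeness by level, N20's window∕count, the admissible box.  `D_j = (M∕M⁻¹)·2ν̄∕((1−ρ_j)κ_j) = M²·…`. [folklore] -/
theorem levelLedgers_histories_of_resummation
    (huA : ∀ K s, Measurable (uA K s)) (huB : ∀ K s, Measurable (uB K s))
    (hsmall : ∀ K, ∀ τ ∈ T K, small K τ ⊆ C K)
    (hθ : ∀ j, 0 < θ j) (hκ : ∀ j, 0 < κ j ∧ κ j ≤ 1) (hρ : ∀ j, 0 ≤ ρ j ∧ ρ j < 1)
    (hcount : ∀ K m, ((((C K).filter fun s => lvl K s = m).card : ℕ) : ℝ) ≤ νbar)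
    (hle : ∀ K, ∀ s ∈ C K, lvl K s ≤ K) (hM : 0 < M)
    (hΔ : ∀ j, Δ j ≤ ρ j * ((1 - κ j) * θ j))
    (hcloseA : ∀ (K : ℕ) (a : ℕ → ℝ), (∀ j, a j ∈ Icc ((1 - κ j) * θ j) (θ j)) → ∀ t, |t| ≤ l₀ → ∀ τ ∈ T K, ∀ s ∈ small K τ,
      ∀ᵐ ω ∂(νA K a t τ), |uA K s ω - uB K s ω| ≤ Δ (lvl K s))
    (hcloseB : ∀ (K : ℕ) (a : ℕ → ℝ), (∀ j, a j ∈ Icc ((1 - κ j) * θ j) (θ j)) → ∀ t, |t| ≤ l₀ → ∀ τ ∈ T K, ∀ s ∈ small K τ,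
      ∀ᵐ ω ∂(νB K a t τ), |uB K s ω - uA K s ω| ≤ Δ (lvl K s))
    (htiltA : ∀ K t, |t| ≤ l₀ → γtA K t ≤ ENNReal.ofReal M • γ0A K ∧ γ0A K ≤ ENNReal.ofReal M • γtA K t)
    (htiltB : ∀ K t, |t| ≤ l₀ → γtB K t ≤ ENNReal.ofReal M • γ0B K ∧ γ0B K ≤ ENNReal.ofReal M • γtB K t)
    (hresA : ∀ (K : ℕ) (a : ℕ → ℝ), (∀ j, a j ∈ Icc ((1 - κ j) * θ j) (θ j)) → ∀ t, |t| ≤ l₀ →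
      ∑ τ ∈ T K, histLaw (νA K a t τ) (small K τ) (uA K) (fun s => a (lvl K s)) = γtA K t)
    (hresB : ∀ (K : ℕ) (a : ℕ → ℝ), (∀ j, a j ∈ Icc ((1 - κ j) * θ j) (θ j)) → ∀ t, |t| ≤ l₀ →
      ∑ τ ∈ T K, histLaw (νB K a t τ) (small K τ) (uB K) (fun s => a (lvl K s)) = γtB K t) :
    ∃ a : ℕ → ℕ → ℝ, (∀ K j, a K j ∈ Icc ((1 - κ j) * θ j) (θ j)) ∧
      LevelLedger l₀ T (fun K t τ => histWeight (νA K (a K) t τ) (small K τ) (uA K) (fun s => a K (lvl K s)))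
        (fun K t τ => histShell (νA K (a K) t τ) (small K τ) (uA K) (uB K) (fun s => a K (lvl K s))) C
        (fun K t s τ => histPiece (νA K (a K) t τ) (small K τ) (uA K) (uB K) (fun s => a K (lvl K s)) s) lvl
        (fun j => M / M⁻¹ * (2 * νbar / ((1 - ρ j) * κ j))) ρ ∧
      LevelLedger l₀ T (fun K t τ => histWeight (νB K (a K) t τ) (small K τ) (uB K) (fun s => a K (lvl K s)))
        (fun K t τ => histShell (νB K (a K) t τ) (small K τ) (uB K) (uA K) (fun s => a K (lvl K s))) C
        (fun K t s τ => histPiece (νB K (a K) t τ) (small K τ) (uB K) (uA K) (fun s => a K (lvl K s)) s) lvl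
        (fun j => M / M⁻¹ * (2 * νbar / ((1 - ρ j) * κ j))) ρ :=
  levelLedgers_histories_of_selectedThresholds (lawA := fun K _ _ => γ0A K) (lawB := fun K _ _ => γ0B K) (M₁ := M) (M₂ := M⁻¹)
    huA huB hsmall hθ hκ hρ hcount hle hM.le (inv_pos.2 hM) (fun _ _ _ _ _ => rfl) (fun _ _ _ _ _ => rfl) hΔ hcloseA hcloseB
    (fun K a ha t ht s _ => envelope_of_resummation (T K) (νA K a t) (small K) (uA K) _ (hresA K a ha t ht).le (htiltA K t ht).1 s)
    (fun K a ha t ht s _ => envelope_of_resummation (T K) (νB K a t) (small K) (uB K) _ (hresB K a ha t ht).le (htiltB K t ht).1 s)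
    (fun K a ha t ht _ _ => massControl_of_resummation (T K) (νA K a t) (small K) (huA K) _ (hresA K a ha t ht) hM (htiltA K t ht).2)
    (fun K a ha t ht _ _ => massControl_of_resummation (T K) (νB K a t) (small K) (huB K) _ (hresB K a ha t ht) hM (htiltB K t ht).2)

end Junction

/-! ## §C′ Road I's `ShellWeightBound` for the two history families, from resummation -/

section RoadI

variable {Ω : ℕ → Type*} [∀ K, MeasurableSpace (Ω K)] {σ ι : Type*} [DecidableEq σ]
  {T : ℕ → Finset ι} {C : ℕ → Finset σ} {small : ℕ → ι → Finset σ} {lvl : ℕ → σ → ℕ}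
  {νA νB : ∀ K : ℕ, (ℕ → ℝ) → ℝ → ι → Measure (Ω K)} [∀ K a t τ, IsFiniteMeasure (νA K a t τ)] [∀ K a t τ, IsFiniteMeasure (νB K a t τ)]
  {γ0A γ0B : ∀ K : ℕ, Measure (Ω K)} [∀ K, IsFiniteMeasure (γ0A K)] [∀ K, IsFiniteMeasure (γ0B K)]
  {γtA γtB : ∀ K : ℕ, ℝ → Measure (Ω K)}
  {uA uB : ∀ K : ℕ, σ → Ω K → ℝ} {θ κ ρ Δ : ℕ → ℝ} {l₀ M νbar : ℝ}

/-- **N21's ROAD I ON HISTORY FAMILIES AT SELECTED THRESHOLDS, LAWS FROM RESUMMATION.**  The data of §C with N20's live window `LiveWindow C lvl N₁ ν̄` (in place of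
`hle`∕`hcount`) + `0 < κ_min ≤ κ_j` + `ρ_j ≤ ½` + N16's rate ⟹ for SOME assignment `a K` per comparison, admissible at every level:
`ShellWeightBound l₀ T A B shA shB (K ↦ C′·ϑ^K)` for the two runs' history letters at `a`, `C′ = 2((N₁+1)·ν̄·(M∕M⁻¹·(4ν̄∕κ_min))·c₁·ϑ^{−N₁})` — n21-a's
`n21_knit_levels_geometric` (p408928) on §C's two ledgers.  Displayed: (RESUM), (TILT), closeness, window, box, rate. [folklore] -/
theorem shellWeightBound_histories_of_resummation {N₁ : ℕ} {κmin c₁ ϑ : ℝ}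
    (huA : ∀ K s, Measurable (uA K s)) (huB : ∀ K s, Measurable (uB K s))
    (hsmall : ∀ K, ∀ τ ∈ T K, small K τ ⊆ C K)
    (hθ : ∀ j, 0 < θ j) (hκ : ∀ j, 0 < κ j ∧ κ j ≤ 1) (hρ : ∀ j, 0 ≤ ρ j ∧ ρ j < 1)
    (hwin : LiveWindow C lvl N₁ νbar) (hM : 0 < M)
    (hΔ : ∀ j, Δ j ≤ ρ j * ((1 - κ j) * θ j))
    (hcloseA : ∀ (K : ℕ) (a : ℕ → ℝ), (∀ j, a j ∈ Icc ((1 - κ j) * θ j) (θ j)) → ∀ t, |t| ≤ l₀ → ∀ τ ∈ T K, ∀ s ∈ small K τ,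
      ∀ᵐ ω ∂(νA K a t τ), |uA K s ω - uB K s ω| ≤ Δ (lvl K s))
    (hcloseB : ∀ (K : ℕ) (a : ℕ → ℝ), (∀ j, a j ∈ Icc ((1 - κ j) * θ j) (θ j)) → ∀ t, |t| ≤ l₀ → ∀ τ ∈ T K, ∀ s ∈ small K τ,
      ∀ᵐ ω ∂(νB K a t τ), |uB K s ω - uA K s ω| ≤ Δ (lvl K s))
    (htiltA : ∀ K t, |t| ≤ l₀ → γtA K t ≤ ENNReal.ofReal M • γ0A K ∧ γ0A K ≤ ENNReal.ofReal M • γtA K t)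
    (htiltB : ∀ K t, |t| ≤ l₀ → γtB K t ≤ ENNReal.ofReal M • γ0B K ∧ γ0B K ≤ ENNReal.ofReal M • γtB K t)
    (hresA : ∀ (K : ℕ) (a : ℕ → ℝ), (∀ j, a j ∈ Icc ((1 - κ j) * θ j) (θ j)) → ∀ t, |t| ≤ l₀ →
      ∑ τ ∈ T K, histLaw (νA K a t τ) (small K τ) (uA K) (fun s => a (lvl K s)) = γtA K t)
    (hresB : ∀ (K : ℕ) (a : ℕ → ℝ), (∀ j, a j ∈ Icc ((1 - κ j) * θ j) (θ j)) → ∀ t, |t| ≤ l₀ →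
      ∑ τ ∈ T K, histLaw (νB K a t τ) (small K τ) (uB K) (fun s => a (lvl K s)) = γtB K t)
    (hκmin : 0 < κmin) (hκminle : ∀ j, κmin ≤ κ j) (hρhalf : ∀ j, ρ j ≤ 1 / 2)
    (hϑ0 : 0 < ϑ) (hϑ1 : ϑ < 1) (hrate : ∀ j, ρ j ≤ c₁ * ϑ ^ j) :
    ∃ a : ℕ → ℕ → ℝ, (∀ K j, a K j ∈ Icc ((1 - κ j) * θ j) (θ j)) ∧
      ShellWeightBound l₀ T (fun K t τ => histWeight (νA K (a K) t τ) (small K τ) (uA K) (fun s => a K (lvl K s)))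
        (fun K t τ => histWeight (νB K (a K) t τ) (small K τ) (uB K) (fun s => a K (lvl K s)))
        (fun K t τ => histShell (νA K (a K) t τ) (small K τ) (uA K) (uB K) (fun s => a K (lvl K s)))
        (fun K t τ => histShell (νB K (a K) t τ) (small K τ) (uB K) (uA K) (fun s => a K (lvl K s)))
        fun K => (2 * ((N₁ + 1) * νbar * (M / M⁻¹ * (2 * (2 * νbar) / κmin)) * c₁ * ϑ⁻¹ ^ N₁)) * ϑ ^ K := by
  obtain ⟨a, hadm, hLA, hLB⟩ := levelLedgers_histories_of_resummation huA huB hsmall hθ hκ hρ hwin.count hwin.le_top hM hΔ hcloseA hcloseB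
    htiltA htiltB hresA hresB
  have hF : 0 ≤ 2 * νbar := by have := hwin.νbar_nonneg; positivity
  have hD : ∀ j, M / M⁻¹ * (2 * νbar / ((1 - ρ j) * κ j)) ≤ M / M⁻¹ * (2 * (2 * νbar) / κmin) := fun j =>
    mul_le_mul_of_nonneg_left (levelConst_le hF (hρhalf j) hκmin (hκminle j)) (div_nonneg hM.le (inv_pos.2 hM).le)
  exact ⟨a, hadm, n21_knit_levels_geometric hLA hLB hwin hwin hD hD hϑ0 hϑ1 hrate hrate⟩

end RoadI

/-! ## §D the coupling marginal commutes with a one-coordinate tilt -/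

section Coupling

variable {X Y : Type*} [MeasurableSpace X] [MeasurableSpace Y]

/-- tilting a measure on `X × Y` by a density that reads the FIRST coordinate only, then taking the first marginal, is the first
marginal tilted: `(γ · (g ∘ fst)).map fst = (γ.map fst) · g` — so the coupling's run-A tilt has run A's tilted law as marginal. [folklore] -/
theorem map_fst_withDensity_comp_fst (γ : Measure (X × Y)) {g : X → ℝ≥0∞} (hg : Measurable g) :
    (γ.withDensity fun p => g p.1).map Prod.fst = (γ.map Prod.fst).withDensity g := by
  ext s hs
  rw [Measure.map_apply measurable_fst hs, withDensity_apply _ (measurable_fst hs), withDensity_apply _ hs,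
    setLIntegral_map hs hg measurable_fst]

end Coupling


end Summit.QuantumFields.YangMills.Theorems.N21SelectedThresholdsHistoriesResummation

end
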